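import Summits.AnomalousDissipation.AnomalousDissipation.Theorems.QuarticGate.Negative.EnergyRow
import Summits.AnomalousDissipation.AnomalousDissipation.Theorems.CubicParityLoud.Negative.EnergyRow
import Summits.AnomalousDissipation.AnomalousDissipation.Theorems.MomentParityMomentClosure
import Summits.AnomalousDissipation.AnomalousDissipation.Theorems.MomentParityGalerkinInvariantLoudStubEnergyFloor
import Literature.Analysis.FluidPDE.StatisticalSolutionEnergyEq
import Literature.Analysis.FluidPDE.StatisticalSolutionProofs
import Literature.Analysis.FluidPDE.EnergySpaceRellich
import Literature.Analysis.FluidPDE.CylindricalGenerator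
import Literature.Analysis.FluidPDE.SteadyNavierStokesWeakForm
import Literature.Analysis.FunctionSpaces.TorusFourierSeries
import Literature.Analysis.FunctionSpaces.TorusTrigPoly

/-!
# `MomentParity.ResolvedDissipation` (stmt-AnomalousDissipation-14284), line `lions-l4-domination`,
# stub K2b — preparation: truncated cylindrical tests, generator error bounds, weighted energy rows

Support file (all results proved) for the stub `stub_limitIsStationarySolution` (Galerkin limits of
admissible laws are stationary statistical solutions): the level-`N` bookkeeping.

* `lowerSemicontinuous_mul_eGradNormSq` — `u ↦ c(u) ‖∇u‖²` is lower semicontinuous on `H` for a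
  continuous finite weight `c` (supremum of continuous band sums);
* `pairing_fourierTruncate_of_isLevel` — `(u, P_N g) = (u, g)` on level-`N` fields (the truncation
  `P_N g` of a smooth solenoidal mean-zero field is a level-`N` band test:
  `GalerkinInvariantLoud.EnergyFloor.isBandTest_fourierTruncate`);
* `abs_nsGeneratorPairing_le_of_bounds`, `abs_nsGeneratorPairing_sub_fourierTruncate_le`,
  `tendsto_truncationError` — the tested generator `⟨F(u), w⟩` is small when `w`, `Δw`, `∇w` are
  uniformly small, whence `|⟨F(u), g⟩ - ⟨F(u), P_N g⟩| ≤ δ_N (1 + |u|²)` with `δ_N → 0`;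
* `integral_pow_mul_energyDefect_eq_zero`, `integral_polynomial_mul_energyDefect_eq_zero` — the
  WEIGHTED ENERGY ROWS of an admissible law at level `N`: `∫ p(|u|²) [(u,f) - ν‖∇u‖²] dμ = 0` for every
  real polynomial `p` (observable `(Σ_a (u,e_a)²)^(n+1)` over the Galerkin frame).
-/

noncomputable section

-- `Summit.<Summit>.<Problem>`: single-conjunct summit, the duplicate namespace segment is mandated.
set_option linter.dupNamespace false

namespace Summit.AnomalousDissipation.AnomalousDissipation.Theorems.MomentParityResolvedDissipation.LimitSSS

open MeasureTheory Filter Topology UnitAddTorus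
open scoped ENNReal NNReal InnerProductSpace RealInnerProductSpace
open Literature.Analysis.FunctionSpaces Literature.Analysis.FluidPDE
open Summit.AnomalousDissipation.AnomalousDissipation.Theses.MomentParity
open Summit.AnomalousDissipation.AnomalousDissipation.Theorems.QuarticGate.Negative

/-! ## Lower semicontinuity of weighted enstrophies -/

/-- **A continuously weighted enstrophy `u ↦ c(u) ‖∇u‖₂²` is lower semicontinuous on `H`** when the
weight `c : H → [0, ∞)` is continuous and finite: the spectral enstrophy is the supremum of its band
sums, each continuous and finite, and finite products of finite continuous `ℝ≥0∞`-valued functions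
are continuous. [folklore] -/
theorem lowerSemicontinuous_mul_eGradNormSq {c : Torus.energySpace (Fin 3) → ℝ≥0∞} (hc : Continuous c)
    (hfin : ∀ u, c u ≠ ⊤) :
    LowerSemicontinuous fun u : Torus.energySpace (Fin 3) =>
      c u * Torus.eGradNormSq (u.1 : UnitAddTorus (Fin 3) → EuclideanSpace ℝ (Fin 3)) := by
  set T : (Fin 3 → ℤ) → Torus.energySpace (Fin 3) → ℝ≥0∞ := fun k u =>
    ENNReal.ofReal (Torus.freqNormSq k) *
      ‖mFourierCoeff (EuclideanSpace.complexify ∘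
        (u.1 : UnitAddTorus (Fin 3) → EuclideanSpace ℝ (Fin 3))) k‖ₑ ^ 2 with hT
  have hTc : ∀ k, Continuous (T k) := fun k =>
    (ENNReal.continuous_const_mul ENNReal.ofReal_ne_top).comp
      ((ENNReal.continuous_pow 2).comp
        ((Torus.continuous_mFourierCoeff_complexify_coe k).comp continuous_subtype_val).enorm)
  have hTfin : ∀ k u, T k u ≠ ⊤ := fun k u =>
    ENNReal.mul_ne_top ENNReal.ofReal_ne_top (ENNReal.pow_ne_top enorm_ne_top)
  have h : (fun u : Torus.energySpace (Fin 3) =>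
      c u * Torus.eGradNormSq (u.1 : UnitAddTorus (Fin 3) → EuclideanSpace ℝ (Fin 3))) =
      fun u => ⨆ s : Finset (Fin 3 → ℤ), c u * (ENNReal.ofReal (4 * Real.pi ^ 2) * ∑ k ∈ s, T k u) := by
    funext u
    rw [Torus.eGradNormSq_eq_tsum, ENNReal.tsum_eq_iSup_sum, ENNReal.mul_iSup, ENNReal.mul_iSup]
  rw [h]
  refine lowerSemicontinuous_iSup fun s => Continuous.lowerSemicontinuous ?_
  have hS : Continuous fun u => ENNReal.ofReal (4 * Real.pi ^ 2) * ∑ k ∈ s, T k u :=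
    (ENNReal.continuous_const_mul ENNReal.ofReal_ne_top).comp
      (continuous_finsetSum s fun k _ => hTc k)
  have hSfin : ∀ u, ENNReal.ofReal (4 * Real.pi ^ 2) * ∑ k ∈ s, T k u ≠ ⊤ := fun u =>
    ENNReal.mul_ne_top ENNReal.ofReal_ne_top (ENNReal.sum_ne_top.2 fun k _ => hTfin k u)
  exact hc.ennreal_mul hS (fun u => Or.inr (hSfin u)) (fun u => Or.inr (hfin u))

/-! ## Truncated test fields -/

/-- **On level-`N` fields the truncation of the test field is invisible**: `(u, P_N g) = (u, g)` for
`u` carried by `0 < |k|² ≤ N²` and `g ∈ L²` (Parseval on the ball). [folklore] -/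
theorem pairing_fourierTruncate_of_isLevel {N : ℕ} {u : Torus.energySpace (Fin 3)} (hu : IsLevel N u)
    {g : UnitAddTorus (Fin 3) → EuclideanSpace ℝ (Fin 3)} (hg : MemLp g 2 volume) :
    Torus.pairing u.1 (Torus.fourierTruncate N g) = Torus.pairing u.1 g := by
  have hband : ∀ k ∉ Torus.freqBall N, mFourierCoeff (EuclideanSpace.complexify ∘
      (u.1 : UnitAddTorus (Fin 3) → EuclideanSpace ℝ (Fin 3))) k = 0 :=
    fun k hk => hu k fun h => hk (Finset.mem_of_mem_erase h)
  have h := Torus.integral_inner_fourierTruncate_eq hg (Lp.memLp u.1) hband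
  unfold Torus.pairing
  calc ∫ x, ⟪(u.1 : UnitAddTorus (Fin 3) → EuclideanSpace ℝ (Fin 3)) x, Torus.fourierTruncate N g x⟫_ℝ
      = ∫ x, ⟪Torus.fourierTruncate N g x, (u.1 : UnitAddTorus (Fin 3) → EuclideanSpace ℝ (Fin 3)) x⟫_ℝ :=
        integral_congr_ae (ae_of_all _ fun x => real_inner_comm _ _)
    _ = ∫ x, ⟪g x, (u.1 : UnitAddTorus (Fin 3) → EuclideanSpace ℝ (Fin 3)) x⟫_ℝ := h
    _ = ∫ x, ⟪(u.1 : UnitAddTorus (Fin 3) → EuclideanSpace ℝ (Fin 3)) x, g x⟫_ℝ :=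
        integral_congr_ae (ae_of_all _ fun x => real_inner_comm _ _)

/-! ## Sup-norm control of the tested generator -/

/-- **The tested generator is small against small fields**: if `‖w‖ ≤ e₀`, `‖Δw‖ ≤ e₂` and
`Σᵢ ‖∂ᵢw‖ ≤ e₃` pointwise, then `|⟨F(u), w⟩| ≤ e₀ ∫‖f‖ + |ν| e₂ (1 + |u|²) + e₃ |u|²` for `u ∈ H`
and an integrable force `f`. [folklore] -/
theorem abs_nsGeneratorPairing_le_of_bounds (ν : ℝ) {f : UnitAddTorus (Fin 3) → EuclideanSpace ℝ (Fin 3)}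
    (hf : Integrable f volume) {w : UnitAddTorus (Fin 3) → EuclideanSpace ℝ (Fin 3)}
    (hw : Torus.IsSmooth w) {e₀ e₂ e₃ : ℝ} (h₀ : ∀ x, ‖w x‖ ≤ e₀)
    (h₂ : ∀ x, ‖Torus.laplacian w x‖ ≤ e₂) (h₃ : ∀ x, ∑ i, ‖Torus.partialDeriv i w x‖ ≤ e₃)
    (u : Torus.energySpace (Fin 3)) :
    |Torus.nsGeneratorPairing ν f u w| ≤
      e₀ * (∫ x, ‖f x‖) + |ν| * (e₂ * (1 + ‖u‖ ^ 2)) + e₃ * ‖u‖ ^ 2 := by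
  set v : UnitAddTorus (Fin 3) → EuclideanSpace ℝ (Fin 3) :=
    (u.1 : UnitAddTorus (Fin 3) → EuclideanSpace ℝ (Fin 3)) with hv
  have hvm : MemLp v 2 volume := Lp.memLp u.1
  have he₂ : 0 ≤ e₂ := (norm_nonneg _).trans (h₂ 0)
  -- the force term
  have h1 : |∫ x, ⟪f x, w x⟫_ℝ| ≤ e₀ * ∫ x, ‖f x‖ := by
    rw [← Real.norm_eq_abs, mul_comm, ← integral_mul_const]
    refine norm_integral_le_of_norm_le (hf.norm.mul_const e₀) (ae_of_all _ fun x => ?_)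
    exact (norm_inner_le_norm _ _).trans (mul_le_mul_of_nonneg_left (h₀ x) (norm_nonneg _))
  -- the Stokes term
  have h2 : |∫ x, ⟪v x, Torus.laplacian w x⟫_ℝ| ≤ e₂ * (1 + ‖u‖ ^ 2) := by
    have hi : Integrable (fun x => (1 + ‖v x‖ ^ 2) * e₂) volume :=
      ((integrable_const (1 : ℝ)).add (hvm.integrable_norm_pow two_ne_zero)).mul_const e₂
    have hpt : ∀ x, ‖⟪v x, Torus.laplacian w x⟫_ℝ‖ ≤ (1 + ‖v x‖ ^ 2) * e₂ := fun x => by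
      refine (norm_inner_le_norm _ _).trans ?_
      have h4 : ‖v x‖ ≤ 1 + ‖v x‖ ^ 2 := by nlinarith [sq_nonneg (‖v x‖ - 1), norm_nonneg (v x)]
      exact mul_le_mul h4 (h₂ x) (norm_nonneg _) (by positivity)
    have hI : ∫ x, (1 + ‖v x‖ ^ 2) * e₂ = (1 + ‖u‖ ^ 2) * e₂ := by
      rw [integral_mul_const, integral_add (integrable_const _) (hvm.integrable_norm_pow two_ne_zero),
        integral_const, hv, Torus.integral_norm_sq_coe_eq, Submodule.coe_norm]
      simp
    rw [← Real.norm_eq_abs, mul_comm, ← hI]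
    exact norm_integral_le_of_norm_le hi (ae_of_all _ hpt)
  -- the inertial term
  have h3 : |Torus.inertialPairing u.1 w| ≤ e₃ * ‖u‖ ^ 2 := by
    have h := (Torus.integrable_inner_fderiv_apply_coe hw h₃ u.1 u.1).2
    rw [Torus.inertialPairing, Submodule.coe_norm, sq]
    exact h
  unfold Torus.nsGeneratorPairing
  calc |(∫ x, ⟪f x, w x⟫_ℝ) + ν * (∫ x, ⟪v x, Torus.laplacian w x⟫_ℝ) + Torus.inertialPairing u.1 w|
      ≤ |∫ x, ⟪f x, w x⟫_ℝ| + |ν * ∫ x, ⟪v x, Torus.laplacian w x⟫_ℝ| + |Torus.inertialPairing u.1 w| :=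
        abs_add_three _ _ _
    _ ≤ e₀ * (∫ x, ‖f x‖) + |ν| * (e₂ * (1 + ‖u‖ ^ 2)) + e₃ * ‖u‖ ^ 2 := by
        rw [abs_mul]
        exact add_le_add_three h1 (mul_le_mul_of_nonneg_left h2 (abs_nonneg ν)) h3

/-- The tested generator is additive in the test field: differences. [folklore] -/
theorem nsGeneratorPairing_sub (ν : ℝ) {f : UnitAddTorus (Fin 3) → EuclideanSpace ℝ (Fin 3)}
    (hf : Integrable f volume) (u : Torus.energySpace (Fin 3))
    {a b : UnitAddTorus (Fin 3) → EuclideanSpace ℝ (Fin 3)} (ha : Torus.IsSmooth a) (hb : Torus.IsSmooth b) :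
    Torus.nsGeneratorPairing ν f u (fun x => a x - b x) =
      Torus.nsGeneratorPairing ν f u a - Torus.nsGeneratorPairing ν f u b := by
  have h := Torus.nsGeneratorPairing_sum_smul ν hf u Finset.univ ![(1 : ℝ), -1] (g := ![a, b])
    (fun i _ => by fin_cases i <;> assumption)
  simpa [Fin.sum_univ_two, sub_eq_add_neg] using h

/-- **Truncation error of the tested generator**: for a smooth field `g`,
`|⟨F(u), g⟩ - ⟨F(u), P_N g⟩| ≤ ε₀ ∫‖f‖ + |ν| ε₂ (1 + |u|²) + ε₃ |u|²`, where `ε₀, ε₂, ε₃` are the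
uniform truncation-error majorants `∑_{k ∉ ball N} ‖·̂(k)‖` of `g`, `Δg` and of the `∂ᵢ g`
(`Torus.norm_sub_fourierTruncate_apply_le`; Robinson–Rodrigo–Sadowski 2016, Thm. 4.4 Step 4). [folklore] -/
theorem abs_nsGeneratorPairing_sub_fourierTruncate_le (ν : ℝ)
    {f : UnitAddTorus (Fin 3) → EuclideanSpace ℝ (Fin 3)} (hf : Integrable f volume)
    {g : UnitAddTorus (Fin 3) → EuclideanSpace ℝ (Fin 3)} (hg : Torus.IsSmooth g) (N : ℕ)
    (u : Torus.energySpace (Fin 3)) :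
    |Torus.nsGeneratorPairing ν f u g - Torus.nsGeneratorPairing ν f u (Torus.fourierTruncate N g)| ≤
      (∑' k : {k // k ∉ Torus.freqBall (d := Fin 3) N},
          ‖mFourierCoeff (EuclideanSpace.complexify ∘ g) k‖) * (∫ x, ‖f x‖) +
        |ν| * ((∑' k : {k // k ∉ Torus.freqBall (d := Fin 3) N},
          ‖mFourierCoeff (EuclideanSpace.complexify ∘ Torus.laplacian g) k‖) * (1 + ‖u‖ ^ 2)) +
        (∑ i, ∑' k : {k // k ∉ Torus.freqBall (d := Fin 3) N},
          ‖mFourierCoeff (EuclideanSpace.complexify ∘ Torus.partialDeriv i g) k‖) * ‖u‖ ^ 2 := by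
  have hP : Torus.IsSmooth (Torus.fourierTruncate N g) := Torus.isSmooth_fourierTruncate N g
  rw [← nsGeneratorPairing_sub ν hf u hg hP]
  refine abs_nsGeneratorPairing_le_of_bounds ν hf (w := fun y => g y - Torus.fourierTruncate N g y)
    (hg.sub hP) (fun x => ?_) (fun x => ?_) (fun x => ?_) u
  · exact Torus.norm_sub_fourierTruncate_apply_le hg N x
  · rw [Torus.laplacian_sub_apply hg hP, Torus.laplacian_fourierTruncate hg]
    exact Torus.norm_sub_fourierTruncate_apply_le hg.laplacian N x
  · refine Finset.sum_le_sum fun i _ => ?_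
    rw [Torus.partialDeriv_sub_apply hg hP, Torus.partialDeriv_fourierTruncate hg]
    exact Torus.norm_sub_fourierTruncate_apply_le (hg.partialDeriv i) N x

/-- **The truncation-error majorants vanish**: for a smooth field `g` and constants `A, B, C`,
`ε₀(N) A + |ν| ε₂(N) B + ε₃(N) C → 0` as `N → ∞` (`tendsto_tsum_compl_norm_mFourierCoeff`). [folklore] -/
theorem tendsto_truncationError (ν : ℝ) {g : UnitAddTorus (Fin 3) → EuclideanSpace ℝ (Fin 3)}
    (hg : Torus.IsSmooth g) (A B C : ℝ) :
    Tendsto (fun N : ℕ =>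
      (∑' k : {k // k ∉ Torus.freqBall (d := Fin 3) N},
          ‖mFourierCoeff (EuclideanSpace.complexify ∘ g) k‖) * A +
        |ν| * ((∑' k : {k // k ∉ Torus.freqBall (d := Fin 3) N},
          ‖mFourierCoeff (EuclideanSpace.complexify ∘ Torus.laplacian g) k‖) * B) +
        (∑ i, ∑' k : {k // k ∉ Torus.freqBall (d := Fin 3) N},
          ‖mFourierCoeff (EuclideanSpace.complexify ∘ Torus.partialDeriv i g) k‖) * C) atTop (𝓝 0) := by
  have h0 := tendsto_tsum_compl_norm_mFourierCoeff hg
  have h2 := tendsto_tsum_compl_norm_mFourierCoeff hg.laplacian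
  have h3 : Tendsto (fun N : ℕ => ∑ i, ∑' k : {k // k ∉ Torus.freqBall (d := Fin 3) N},
      ‖mFourierCoeff (EuclideanSpace.complexify ∘ Torus.partialDeriv i g) k‖) atTop (𝓝 0) := by
    have h : Tendsto (fun N : ℕ => ∑ i, ∑' k : {k // k ∉ Torus.freqBall (d := Fin 3) N},
        ‖mFourierCoeff (EuclideanSpace.complexify ∘ Torus.partialDeriv i g) k‖) atTop
        (𝓝 (∑ _i : Fin 3, (0 : ℝ))) :=
      tendsto_finsetSum _ fun i _ => tendsto_tsum_compl_norm_mFourierCoeff (hg.partialDeriv i)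
    simpa using h
  simpa using ((h0.mul_const A).add ((h2.mul_const B).const_mul |ν|)).add (h3.mul_const C)

/-! ## Weighted energy rows at level `N` -/

/-- **The differential of the powers of the energy observable**: over the Galerkin frame of level
`N`, `∇[(Σ_a (u,e_a)²)^(n+1)](u) = 2(n+1) (Σ_a (u,e_a)²)^n P_N u` for every `u ∈ H`. [folklore] -/
theorem polyGrad_energyPoly_pow (N n : ℕ) (u : Torus.energySpace (Fin 3)) :
    polyGrad (Theorems.CubicParityLoud.Negative.frameG N)
        (Theorems.CubicParityLoud.Negative.energyPoly _ ^ (n + 1)) u =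
      fun x => (((n : ℝ) + 1) *
          (∑ i, Torus.pairing u.1 (Theorems.CubicParityLoud.Negative.frameG N i) ^ 2) ^ n * 2) •
        Torus.fourierTruncate N (u.1 : UnitAddTorus (Fin 3) → EuclideanSpace ℝ (Fin 3)) x := by
  have hE := Theorems.CubicParityLoud.Negative.polyGrad_energy N u
  funext x
  have hEx : ∑ i, (MvPolynomial.eval (fun j => Torus.pairing u.1 (Theorems.CubicParityLoud.Negative.frameG N j))
      (MvPolynomial.pderiv i (Theorems.CubicParityLoud.Negative.energyPoly _))) •
        Theorems.CubicParityLoud.Negative.frameG N i x =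
      (2 : ℝ) • Torus.fourierTruncate N (u.1 : UnitAddTorus (Fin 3) → EuclideanSpace ℝ (Fin 3)) x :=
    congrFun hE x
  show ∑ i, (MvPolynomial.eval (fun j => Torus.pairing u.1 (Theorems.CubicParityLoud.Negative.frameG N j))
      (MvPolynomial.pderiv i (Theorems.CubicParityLoud.Negative.energyPoly _ ^ (n + 1)))) •
        Theorems.CubicParityLoud.Negative.frameG N i x = _
  have hev : ∀ i, MvPolynomial.eval (fun j => Torus.pairing u.1 (Theorems.CubicParityLoud.Negative.frameG N j))
      (MvPolynomial.pderiv i (Theorems.CubicParityLoud.Negative.energyPoly _ ^ (n + 1))) =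
      (((n : ℝ) + 1) * (∑ j, Torus.pairing u.1 (Theorems.CubicParityLoud.Negative.frameG N j) ^ 2) ^ n) *
        MvPolynomial.eval (fun j => Torus.pairing u.1 (Theorems.CubicParityLoud.Negative.frameG N j))
          (MvPolynomial.pderiv i (Theorems.CubicParityLoud.Negative.energyPoly _)) := by
    intro i
    rw [Derivation.leibniz_pow, Nat.add_sub_cancel, map_nsmul, smul_eq_mul, map_mul, map_pow,
      nsmul_eq_mul]
    simp [Theorems.CubicParityLoud.Negative.energyPoly, map_sum]
    ring
  simp_rw [hev, mul_smul, ← Finset.smul_sum, hEx]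

/-- **The weighted energy row integrand on level-`N` fields**:
`⟨F(u), ∇[(Σ_a (u,e_a)²)^(n+1)](u)⟩ = 2(n+1) |u|^{2n} ((u,f) - ν‖∇u‖²)` (`P_N u = u`, `b(u,u,u) = 0`,
Parseval for the frame). [folklore] -/
theorem nsGeneratorPairing_energyPoly_pow_of_isLevel (ν : ℝ)
    (f : UnitAddTorus (Fin 3) → EuclideanSpace ℝ (Fin 3)) {N : ℕ} (n : ℕ)
    {u : Torus.energySpace (Fin 3)} (hu : IsLevel N u) :
    Torus.nsGeneratorPairing ν f u (polyGrad (Theorems.CubicParityLoud.Negative.frameG N)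
        (Theorems.CubicParityLoud.Negative.energyPoly _ ^ (n + 1)) u) =
      (((n : ℝ) + 1) * (‖u‖ ^ 2) ^ n * 2) *
        (Torus.pairing u.1 f -
          ν * (Torus.eGradNormSq (u.1 : UnitAddTorus (Fin 3) → EuclideanSpace ℝ (Fin 3))).toReal) := by
  have hS : ∑ i, Torus.pairing u.1 (Theorems.CubicParityLoud.Negative.frameG N i) ^ 2 = ‖u‖ ^ 2 := by
    have h1 := Torus.sum_galerkinTest_eq (d := Fin 3) N one_pos (fun g => Torus.pairing u.1 g ^ 2)
    change ∑ i, Torus.pairing u.1 ((Torus.galerkinTest (d := Fin 3) N one_pos).g i) ^ 2 = _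
    rw [h1]
    have h2 := Torus.sum_integral_inner_frameField_sq u.2 N
    simp only [Torus.pairing] at h2 ⊢
    have h3 : ∫ y, ‖Torus.fourierTruncate N (u.1 : UnitAddTorus (Fin 3) → EuclideanSpace ℝ (Fin 3)) y‖ ^ 2 =
        ∫ y, ‖(u.1 : UnitAddTorus (Fin 3) → EuclideanSpace ℝ (Fin 3)) y‖ ^ 2 :=
      integral_congr_ae ((Theorems.CubicParityLoud.Negative.fourierTruncate_ae_eq_of_isLevel hu).mono
        fun x hx => by simp only at hx; simp only [hx])
    rw [h2, h3, Torus.integral_norm_sq_coe_eq, Submodule.coe_norm]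
  rw [polyGrad_energyPoly_pow, Torus.nsGeneratorPairing_smul_fourierTruncate, hS,
    Theorems.CubicParityLoud.Negative.integral_inner_fourierTruncate_of_isLevel hu,
    Theorems.CubicParityLoud.Negative.eGradNormSq_fourierTruncate_of_isLevel hu,
    Theorems.CubicParityLoud.Negative.inertialPairing_fourierTruncate_of_isLevel hu, add_zero]

section Rows

variable {ν : ℝ} {f : UnitAddTorus (Fin 3) → EuclideanSpace ℝ (Fin 3)} {N : ℕ} {R : ℝ}
  {μ : Measure (Torus.energySpace (Fin 3))}

/-- The energy defect `(u,f) - ν‖∇u‖²` of a level-`N` law in the ball `‖u‖ ≤ R` is bounded a.e.: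
`|(u,f) - ν‖∇u‖²| ≤ R ‖f‖₂ + |ν| 4π²N²R²` (Cauchy–Schwarz and Bernstein). [folklore] -/
theorem ae_abs_energyDefect_le (hf : MemLp f 2 volume) (hlev : ∀ᵐ u ∂μ, IsLevel N u)
    (hR : ∀ᵐ u ∂μ, ‖u‖ ≤ R) :
    ∀ᵐ u ∂μ, |Torus.pairing u.1 f -
        ν * (Torus.eGradNormSq (u.1 : UnitAddTorus (Fin 3) → EuclideanSpace ℝ (Fin 3))).toReal| ≤
      R * ‖hf.toLp f‖ + |ν| * (4 * Real.pi ^ 2 * (N : ℝ) ^ 2 * R ^ 2) := by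
  filter_upwards [hlev, hR] with u hu huR
  have hR0 : 0 ≤ R := (norm_nonneg u).trans huR
  have h1 : |Torus.pairing u.1 f| ≤ R * ‖hf.toLp f‖ :=
    (Torus.abs_pairing_coe_le hf u).trans (mul_le_mul_of_nonneg_right huR (norm_nonneg _))
  have h2 : (Torus.eGradNormSq (u.1 : UnitAddTorus (Fin 3) → EuclideanSpace ℝ (Fin 3))).toReal ≤
      4 * Real.pi ^ 2 * (N : ℝ) ^ 2 * R ^ 2 := by
    refine ENNReal.toReal_le_of_le_ofReal (by positivity)
      ((Theorems.CubicParityLoud.Negative.eGradNormSq_le_of_isLevel hu).trans (ENNReal.ofReal_le_ofReal ?_))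
    gcongr
  have h3 : |ν * (Torus.eGradNormSq (u.1 : UnitAddTorus (Fin 3) → EuclideanSpace ℝ (Fin 3))).toReal| ≤
      |ν| * (4 * Real.pi ^ 2 * (N : ℝ) ^ 2 * R ^ 2) := by
    rw [abs_mul, abs_of_nonneg ENNReal.toReal_nonneg]
    exact mul_le_mul_of_nonneg_left h2 (abs_nonneg ν)
  exact (abs_sub _ _).trans (add_le_add h1 h3)

/-- The energy defect is a.e. strongly measurable. [folklore] -/
theorem aestronglyMeasurable_energyDefect (hf : MemLp f 2 volume) :
    AEStronglyMeasurable (fun u : Torus.energySpace (Fin 3) => Torus.pairing u.1 f -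
      ν * (Torus.eGradNormSq (u.1 : UnitAddTorus (Fin 3) → EuclideanSpace ℝ (Fin 3))).toReal) μ :=
  (Torus.continuous_pairing_coe hf).aestronglyMeasurable.sub
    ((Torus.measurable_eGradNormSq_coe.ennreal_toReal.const_mul ν).aestronglyMeasurable)

/-- **A bounded-weight multiple of the energy defect is integrable** for a finite level-`N` law in
the ball: `u ↦ φ(u) ((u,f) - ν‖∇u‖²)` with `φ` a.e. strongly measurable and a.e. bounded. [folklore] -/
theorem integrable_mul_energyDefect [IsFiniteMeasure μ] (hf : MemLp f 2 volume)
    (hlev : ∀ᵐ u ∂μ, IsLevel N u) (hR : ∀ᵐ u ∂μ, ‖u‖ ≤ R) {φ : Torus.energySpace (Fin 3) → ℝ}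
    (hφ : AEStronglyMeasurable φ μ) {C : ℝ} (hC : ∀ᵐ u ∂μ, |φ u| ≤ C) :
    Integrable (fun u : Torus.energySpace (Fin 3) => φ u * (Torus.pairing u.1 f -
      ν * (Torus.eGradNormSq (u.1 : UnitAddTorus (Fin 3) → EuclideanSpace ℝ (Fin 3))).toReal)) μ := by
  refine Integrable.mono' (integrable_const (C * (R * ‖hf.toLp f‖ + |ν| * (4 * Real.pi ^ 2 * (N : ℝ) ^ 2 * R ^ 2))))
    (hφ.mul (aestronglyMeasurable_energyDefect hf)) ?_
  filter_upwards [hC, ae_abs_energyDefect_le (ν := ν) hf hlev hR] with u h1 h2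
  rw [norm_mul, Real.norm_eq_abs, Real.norm_eq_abs]
  exact mul_le_mul h1 h2 (abs_nonneg _) ((abs_nonneg _).trans h1)

/-- **Monomially weighted energy rows.** For a law `μ` carried by level-`N` fields and polynomially
stationary at every degree for Galerkin NS at `(ν, f)`,
`∫ |u|^{2n} [(u,f) - ν‖∇u‖²] dμ = 0` for every `n` — the row of the observable `(Σ_a (u,e_a)²)^(n+1)`
over the Galerkin frame of level `N`. [folklore] -/
theorem integral_pow_mul_energyDefect_eq_zero (hlev : ∀ᵐ u ∂μ, IsLevel N u)
    (hstat : ∀ d : ℕ, IsPolyStationary ν f N d μ) (n : ℕ) :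
    ∫ u, (‖u‖ ^ 2) ^ n * (Torus.pairing u.1 f -
      ν * (Torus.eGradNormSq (u.1 : UnitAddTorus (Fin 3) → EuclideanSpace ℝ (Fin 3))).toReal) ∂μ = 0 := by
  set P : MvPolynomial (Fin (Torus.galerkinTest (d := Fin 3) N one_pos).m) ℝ :=
    Theorems.CubicParityLoud.Negative.energyPoly _ ^ (n + 1) with hP
  obtain ⟨-, h0⟩ := hstat (P.totalDegree + 1) _ (Theorems.CubicParityLoud.Negative.frameG N) P
    (fun i => Theorems.CubicParityLoud.Negative.isBandTest_frameG N i) le_rfl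
  have hae : (fun u => Torus.nsGeneratorPairing ν f u
      (polyGrad (Theorems.CubicParityLoud.Negative.frameG N) P u)) =ᵐ[μ]
      fun u => (((n : ℝ) + 1) * 2) * ((‖u‖ ^ 2) ^ n * (Torus.pairing u.1 f -
        ν * (Torus.eGradNormSq (u.1 : UnitAddTorus (Fin 3) → EuclideanSpace ℝ (Fin 3))).toReal)) := by
    filter_upwards [hlev] with u hu
    rw [hP, nsGeneratorPairing_energyPoly_pow_of_isLevel ν f n hu]
    ring
  rw [integral_congr_ae hae, integral_const_mul] at h0
  have hc : ((n : ℝ) + 1) * 2 ≠ 0 := by positivity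
  exact (mul_eq_zero.1 h0).resolve_left hc

end Rows

/-- **Polynomially weighted energy rows**: `∫ p(|u|²) [(u,f) - ν‖∇u‖²] dμ = 0` for every real
polynomial `p` and every finite law carried by level-`N` fields in a ball, polynomially stationary at
every degree for Galerkin NS at `(ν, f)`, `f ∈ L²` (linearity over the monomial rows). [folklore] -/
theorem integral_polynomial_mul_energyDefect_eq_zero :
    ∀ (ν : ℝ) (f : UnitAddTorus (Fin 3) → EuclideanSpace ℝ (Fin 3)) (N : ℕ) (R : ℝ)
      (μ : Measure (Torus.energySpace (Fin 3))), IsFiniteMeasure μ → MemLp f 2 volume →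
      (∀ᵐ u ∂μ, IsLevel N u) → (∀ᵐ u ∂μ, ‖u‖ ≤ R) → (∀ d : ℕ, IsPolyStationary ν f N d μ) →
      ∀ p : Polynomial ℝ, ∫ u, p.eval (‖u‖ ^ 2) * (Torus.pairing u.1 f -
        ν * (Torus.eGradNormSq (u.1 : UnitAddTorus (Fin 3) → EuclideanSpace ℝ (Fin 3))).toReal) ∂μ = 0 := by
  intro ν f N R μ hμ hf hlev hR hstat p
  have hint : ∀ i : ℕ, Integrable (fun u : Torus.energySpace (Fin 3) =>
      (p.coeff i * (‖u‖ ^ 2) ^ i) * (Torus.pairing u.1 f -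
        ν * (Torus.eGradNormSq (u.1 : UnitAddTorus (Fin 3) → EuclideanSpace ℝ (Fin 3))).toReal)) μ := by
    intro i
    refine integrable_mul_energyDefect hf hlev hR
      ((continuous_const.mul ((continuous_norm.pow 2).pow i)).aestronglyMeasurable)
      (C := |p.coeff i| * (R ^ 2) ^ i) ?_
    filter_upwards [hR] with u hu
    rw [abs_mul, abs_of_nonneg (by positivity : (0 : ℝ) ≤ (‖u‖ ^ 2) ^ i)]
    refine mul_le_mul_of_nonneg_left ?_ (abs_nonneg _)
    exact pow_le_pow_left₀ (by positivity) (pow_le_pow_left₀ (norm_nonneg _) hu 2) i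
  simp_rw [Polynomial.eval_eq_sum_range, Finset.sum_mul]
  rw [integral_finsetSum _ fun i _ => hint i]
  refine Finset.sum_eq_zero fun i _ => ?_
  simp_rw [mul_assoc]
  rw [integral_const_mul, integral_pow_mul_energyDefect_eq_zero hlev hstat i, mul_zero]


end Summit.AnomalousDissipation.AnomalousDissipation.Theorems.MomentParityResolvedDissipation.LimitSSS

end
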